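import Summits.BirchSwinnertonDyer.BirchSwinnertonDyer.Theorems.GenusKolyvaginAtTwoMinimalTwinBSDTwoRouteLedgerLine25Egg
import Summits.BirchSwinnertonDyer.BirchSwinnertonDyer.Theorems.GenusKolyvaginAtTwoMinimalTwinBSDTwoEggSplit
import Literature.NumberTheory.EllipticCurves.TwoAdicImageNonSurjectiveFamiliesProofs
import Literature.NumberTheory.EllipticCurves.TwoAdicImageQuadraticTwistProofs
import Literature.NumberTheory.EllipticCurves.ExceptionalPrimesDensityModels
import HarnessLib

/-!
# Route `GenusKolyvaginAtTwo` (rev 57/58/59), crux U₂ `MinimalTwinBSDTwo` (stmt-BirchSwinnertonDyer-22985): THE IDENTITY-COMPONENT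
# RESIDUAL OF LINE 23 IS THE SIBLING ROUTE'S `S_id` BY NAME — the route hands U₂ only twins with SURJECTIVE 2-ADIC IMAGE (all levels
# `2ⁿ`, for free), and on those `hTw0^{id}` ⟸ `S_id` + GZK (the director (548)(A) / -imc merge bridge, with NO small-image remainder)

Seat `bsd-line-gk2-p3` g29 (PROVER seat 3/3, cell `bsd-f1-sign2`), `--supports stmt-BirchSwinnertonDyer-22985` (helper; closes nothing).
THEOREMS ONLY (no definition, no named fact, no `sorry`); standard axioms.  **BSD is NOT proved by this file; U₂ / `S_id` / the wall / the
supplies are NOT proved; no item is closed.**  §1 is UNCONDITIONAL; §2 is CONDITIONAL on GZK only (`rank_eq_analyticRank_of_analyticRank_le_one`,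
item 19921) and DISPLAYS `S_id` as a hypothesis; §3–§4 are CONDITIONAL on the route's items exactly like `closes` (rev 57) and this seat's
rev-57/58 ledgers (`…RouteLedgerLine25Surjective` p769550, `…RouteLedgerLine25Egg` p770584), of which they are the refinement asked for by
director-bsd (548)(A)(ii) / -imc 11:22:39Z (2) (2026-08-30): LINE 23 v1.5/v1.6's residual S4″b := «`S_id`-item ∘ an M-sized bridge».

THE POINT.  -imc's merge answer splits S4″'s second disjunct `hTw0^{id}` (non-CM, `r_an = 1`, `#Sel₂ = 2`, `Δ > 0`, `C` odd, `¬MeetsEgg`)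
as S4″b₁ := `S_id` ∘ bridge (BIG 2-adic image) ⊔ S4″b₂ := `hTw0^{id} ∧ ¬(∀ n, ρ̄_{2ⁿ} onto)` (small image, ⊂ 23716, «never displayed as
covered»), because `S_id` (route `ByReductionTypeAtTwo`, crux 23715, line «egg_kolyvagin_two» v6; promoted to the support item
`RankOneAtTwoBigImageIdLocus`) carries the binder `∀ n, W.HasSurjectiveModNGaloisRep 2ⁿ` while p770584's declared residual carries only
`ρ̄_{W,2}` onto.  But FOR THE PURPOSE OF `closes` THE SMALL-IMAGE PART IS EMPTY: every twin `Wd = Cd • E^(d_K)` the deciding theorem hands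
to U₂ is the twist of a HABITAT curve (`∀ n ≥ 1, ρ̄_{E,2ⁿ}` onto — binder `hρ` of both supply cruxes), and the surjective 2-ADIC habitat is a
union of quadratic-twist classes (tree, unconditional: Literature `forall_hasSurjectiveModNGaloisRep_two_pow_quadraticTwist_iff` —
Dokchitser–Dokchitser (1)–(3) + the mod-`8` lift, Rouse–Zureick-Brown Rem. 1.6 — with model independence `hasSurjectiveModNGaloisRep_smul_iff`).
So the S₃-slicing of p769550 upgrades for free to a ♯-slicing («`ρ̄_{W,2ⁿ}` onto for every `n`»), the residual `hTw0^{id}` may be declared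
with the full tower, and then it IS `S_id` modulo GZK (`r_an = 1 ⟹ r_MW = 1`) and two PROVED dictionary entries (`#Sel₂ = 2` at rank `1`
⟹ `E(ℚ)[2] = 0 ∧ Ш(E)[2] = 0`: `Egg.shaTwoTrivial_of_natCard_selmerGroup_eq_two`, `GenusKolyTwin.noRationalTwoTorsion_of_hasSurjectiveModNGaloisRep`;
`ord₂ C = 0 ⟹ ¬ 2 ∣ C`).

* §1 **`forall_hasSurjectiveModNGaloisRep_two_pow_of_model_twist`** (UNCONDITIONAL) — `∀ n ≥ 1, ρ̄_{E,2ⁿ}` onto, `d ≠ 0`, `C • E^(d) = Wd`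
  ⟹ `∀ n, ρ̄_{Wd,2ⁿ}` onto (`n = 0` included); `…_two_pow'` = the same in the habitat's cast `(2 : ℤ) ^ n`, `0 < n`.
* §2 **`hTw0idSharp_of_idLocus_of_GZK`** — GZK → `S_id` (signature VERBATIM = the minted item's) → `hTw0^{id,♯}` := `BSD₂` for non-CM globally
  minimal `W` with `r_an = 1`, `#Sel₂ = 2`, `∀ n, ρ̄_{W,2ⁿ}` onto, `0 < Δ`, `ord₂ C(W) = 0`, `¬MeetsEgg W`.  (The bridge; M-sized as -imc priced.)
* §3 **`nonCMAtTwo_of_items_of_tamagawaSlicedSharpTwin_line25`** — `closes` (rev 57) with `hTw : MinimalTwinBSDTwo` REPLACED by `hTw0♯` /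
  `hTw1♯` := p769550's S₃-cells `hTw0ˢ` / `hTw1ˢ` with `ρ̄_{W,2}` onto UPGRADED to `∀ n, ρ̄_{W,2ⁿ}` onto; proof = p769550 verbatim except
  that the twin's image certificate comes from §1.  NET: **U₂|`closes` ≡ hTw0♯ + hTw1♯ — U₂ is consumed only on curves with surjective
  2-adic image** (which are automatically non-CM and `S₃`).
* §4 **`nonCMAtTwo_of_items_of_slicedWall_of_reversedSuppliesEgg_of_idLocus_line25`** — p770584 §2 with its DECLARED RESIDUAL `hTw0id`
  REPLACED by `S_id` (verbatim signature; BY NAME in the companion file once the item is in the tree): **U₂|`closes` ⟸ S1⁺ + S1⁻ + S2″⁺ +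
  S2⁻′ + `S_id` + PRINT** — NO residual of LINE 23 is left inside the cells `closes` consumes; the ε = −1 sub-cell is ONE item shared by
  TWO routes (director (548)(A): dedup by name), with no small-image remainder on this route's side.

HONEST READING (planner currency).  Nothing here is progress on BSD: `S_id` is beyond print (the two-transposition door T-2q / AN-26 of the
sibling line), the wall and the supplies are beyond print, GZ/GZK/modularity/Milne are statement-only print facts.  What is kernel-checked is
bookkeeping: the U₂-residual of LINE 23 inside the consumed cells is IDENTICAL (not merely comparable) to the sibling route's ε = −1 object.

References: [DokchitserDokchitserMathZ2012] Thm. (1)–(3); [RouseZureickbrown2015] Rem. 1.6, §3 Lemma; [SilvermanAEC2009] X.4.2, X.5 Cor. 5.4,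
III.3.1 (b); [Kramer1981] §2 Props. 3, 6; [MazurRubin2010] Cor. 3.4 (i), Prop. 3.3; [GrossZagier1986] V.§2 (2.2); [Kolyvagin1989Izv] Thm. A;
[Miller2011LMS] Def. 1.1.
-/

set_option autoImplicit false
set_option linter.dupNamespace false -- `Summit.<P>.<Sub>` repeats `BirchSwinnertonDyer` (D-0017)

noncomputable section

open scoped Classical

open WeierstrassCurve NumberField Literature.NumberTheory.EllipticCurves
  Literature.NumberTheory.EllipticCurves.ModularForms
  Literature.NumberTheory.EllipticCurves.Rank1Residual
  Literature.NumberTheory.EllipticCurves.Rank1Residual.Typed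
  Literature.NumberTheory.EllipticCurves.KrizLi2019
  Summit.BirchSwinnertonDyer.Rank1Residual
  Summit.BirchSwinnertonDyer.Rank1Residual.AdditivePotMult
  Summit.BirchSwinnertonDyer.Rank1Residual.F1Sign2
  Summit.BirchSwinnertonDyer.BirchSwinnertonDyer.Rank1Residual
  Summit.BirchSwinnertonDyer.BirchSwinnertonDyer.Theses.GenusKolyvaginAtTwo
  Summit.BirchSwinnertonDyer.BirchSwinnertonDyer.Theorems.CMExactDescent
  Summit.BirchSwinnertonDyer.BirchSwinnertonDyer.Theorems.GenusExact.TwinSwap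
  Summit.BirchSwinnertonDyer.BirchSwinnertonDyer.Theorems.GenusExact.TwinSwap.OneBit
  Summit.BirchSwinnertonDyer.BirchSwinnertonDyer.Theorems.GenusExact.PlusDescent

namespace Summit.BirchSwinnertonDyer.BirchSwinnertonDyer.Theorems.GenusExact.TwinSwap.Ledger.Line25

/-! ## §1 The twins `closes` hands to U₂ have surjective 2-adic image (UNCONDITIONAL) -/

/-- **Every `ℚ`-model of a quadratic twist of a habitat curve has surjective 2-adic image.**  `W/ℚ` elliptic with `ρ̄_{W,2ⁿ}` onto for
every `n ≥ 1`, `d ≠ 0`, `C • W^(d) = Wd` ⟹ `ρ̄_{Wd,2ⁿ} : Γ_ℚ → Aut(Wd[2ⁿ])` onto for EVERY `n` (the level `2⁰` is the trivial group).  The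
surjective 2-adic habitat is a union of twist classes: `ρ̄_{E^(d),2^m}` onto ∀ `m` ⟺ `ρ̄_{E,2^m}` onto ∀ `m` (Dokchitser–Dokchitser (1)–(3) are
twist-invariant and level `8` lifts, tree `forall_hasSurjectiveModNGaloisRep_two_pow_quadraticTwist_iff`,
`forall_hasSurjectiveModNGaloisRep_two_pow_iff_eight`), and surjectivity is model-independent (`hasSurjectiveModNGaloisRep_smul_iff`).
UNCONDITIONAL.  [cite: DokchitserDokchitserMathZ2012, Theorem (1)–(3)] [cite: RouseZureickbrown2015, Remark 1.6 and §3 Lemma]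
[cite: SilvermanAEC2009, X.5 Cor. 5.4 and III.3.1(b)] -/
theorem forall_hasSurjectiveModNGaloisRep_two_pow_of_model_twist (W : WeierstrassCurve ℚ) [W.IsElliptic]
    (hρ : ∀ n : ℕ, 0 < n → W.HasSurjectiveModNGaloisRep ((2 : ℤ) ^ n)) {d : ℚ} (hd : d ≠ 0)
    {Wd : WeierstrassCurve ℚ} (C : VariableChange ℚ) (hC : C • W.quadraticTwist d = Wd) :
    ∀ n : ℕ, Wd.HasSurjectiveModNGaloisRep ((2 ^ n : ℕ) : ℤ) := by
  have h8 : W.HasSurjectiveModNGaloisRep 8 := by simpa using hρ 3 (by norm_num)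
  have hW : ∀ m : ℕ, W.HasSurjectiveModNGaloisRep ((2 ^ m : ℕ) : ℤ) :=
    (forall_hasSurjectiveModNGaloisRep_two_pow_iff_eight W).mpr h8
  have htw : ∀ m : ℕ, (W.quadraticTwist d).HasSurjectiveModNGaloisRep ((2 ^ m : ℕ) : ℤ) :=
    (forall_hasSurjectiveModNGaloisRep_two_pow_quadraticTwist_iff W hd).mpr hW
  intro n
  rw [← hC, hasSurjectiveModNGaloisRep_smul_iff]
  exact htw n

/-- The same in the habitat's own cast: `∀ n ≥ 1, ρ̄_{Wd,(2:ℤ)^n}` onto — so the twin `Wd` of a habitat curve is itself a curve of the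
`2`-adic habitat (every binder `hρ` of the route transfers to the twin).  UNCONDITIONAL.
[cite: DokchitserDokchitserMathZ2012, Theorem (1)–(3)] [cite: RouseZureickbrown2015, Remark 1.6] -/
theorem forall_hasSurjectiveModNGaloisRep_two_pow_of_model_twist' (W : WeierstrassCurve ℚ) [W.IsElliptic]
    (hρ : ∀ n : ℕ, 0 < n → W.HasSurjectiveModNGaloisRep ((2 : ℤ) ^ n)) {d : ℚ} (hd : d ≠ 0)
    {Wd : WeierstrassCurve ℚ} (C : VariableChange ℚ) (hC : C • W.quadraticTwist d = Wd) :
    ∀ n : ℕ, 0 < n → Wd.HasSurjectiveModNGaloisRep ((2 : ℤ) ^ n) := by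
  intro n _
  have h := forall_hasSurjectiveModNGaloisRep_two_pow_of_model_twist W hρ hd C hC n
  simpa using h

/-- The two shapes of the big-image binder agree: `∀ n, ρ̄_{W,((2^n : ℕ) : ℤ)}` onto ⟸ `∀ n ≥ 1, ρ̄_{W,(2:ℤ)^n}` onto (level `2⁰ = 1`:
`Aut(W[1])` is trivial — obtained here from the tree's mod-`8` lift rather than by hand).  UNCONDITIONAL.
[cite: RouseZureickbrown2015, §3 Lemma] -/
theorem forall_hasSurjectiveModNGaloisRep_two_pow_cast (W : WeierstrassCurve ℚ) [W.IsElliptic]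
    (hρ : ∀ n : ℕ, 0 < n → W.HasSurjectiveModNGaloisRep ((2 : ℤ) ^ n)) :
    ∀ n : ℕ, W.HasSurjectiveModNGaloisRep ((2 ^ n : ℕ) : ℤ) := by
  have h8 : W.HasSurjectiveModNGaloisRep 8 := by simpa using hρ 3 (by norm_num)
  exact (forall_hasSurjectiveModNGaloisRep_two_pow_iff_eight W).mpr h8

/-! ## §2 The bridge: on the surjective-2-adic-image slice the residual `hTw0^{id}` IS `S_id` (mod GZK) -/

/-- **THE S4″b BRIDGE (director (548)(A)(ii), -imc 11:22:39Z (2)).**  `hGZK` = Gross–Zagier–Kolyvagin «`r_an ≤ 1 ⟹ r_MW = r_an`»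
(statement-only print fact, item 19921); `hSid` = the sibling route's `S_id` (line «egg_kolyvagin_two» v6 l.372 of crux 23715, promoted to
the support item `RankOneAtTwoBigImageIdLocus` of route `ByReductionTypeAtTwo` — signature VERBATIM): `BSD₂` for non-CM globally minimal `W`
with `ρ̄_{W,2ⁿ}` onto ∀ `n`, `r_an = 1`, `0 < Δ`, `E(ℚ)[2] = 0`, `Ш(E)[2] = 0`, `E(ℚ) ⊂ E⁰(ℝ)`, `∏ c_ℓ` odd.  CONCLUSION: `hTw0^{id,♯}` —
`BSD₂` for every non-CM globally minimal `W` with `r_an = 1`, `#Sel₂(W) = 2`, `ρ̄_{W,2ⁿ}` onto ∀ `n`, `0 < Δ`, `ord₂ C(W) = 0`, `¬ MeetsEgg W`.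
Dictionary: rank `1` (GZK) and `#Sel₂ = 2` ⟹ `Ш(W)[2] = 0` (`Egg.shaTwoTrivial_of_natCard_selmerGroup_eq_two`, Silverman X.4.2);
`ρ̄_{W,2}` onto ⟹ `W(ℚ)[2] = 0` (`GenusKolyTwin.noRationalTwoTorsion_of_hasSurjectiveModNGaloisRep`); `ord₂ C = 0`, `C > 0` ⟹ `2 ∤ C`.
CONDITIONAL on the displayed hypotheses; proves nothing about BSD by itself; closes nothing.
[cite: SilvermanAEC2009, X.4.2] [cite: Kolyvagin1989Izv, Thm. A] [cite: GrossZagier1986, V.§2 (2.2)] -/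
theorem hTw0idSharp_of_idLocus_of_GZK (hGZK : rank_eq_analyticRank_of_analyticRank_le_one)
    (hSid : ∀ (W : WeierstrassCurve ℚ) [W.IsElliptic] [W.IsGloballyMinimal], ¬ W.HasCM →
      (∀ n : ℕ, W.HasSurjectiveModNGaloisRep ((2 ^ n : ℕ) : ℤ)) → W.analyticRank = 1 →
      (0 < W.Δ ∧ Summit.BirchSwinnertonDyer.Rank1Residual.F1Sign2.NoRationalTwoTorsion W ∧
        Summit.BirchSwinnertonDyer.Rank1Residual.F1Sign2.ShaTwoTrivial W ∧
        ¬ Summit.BirchSwinnertonDyer.Rank1Residual.F1Sign2.MeetsEgg W ∧ ¬ 2 ∣ W.tamagawaProduct) →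
      Literature.NumberTheory.EllipticCurves.BSDp W 2) :
    ∀ (W : WeierstrassCurve ℚ) [W.IsElliptic] [W.IsGloballyMinimal], ¬ W.HasCM → W.analyticRank = 1 →
      Nat.card (W.selmerGroup 2) = 2 → (∀ n : ℕ, W.HasSurjectiveModNGaloisRep ((2 ^ n : ℕ) : ℤ)) → 0 < W.Δ →
      padicValNat 2 W.tamagawaProduct = 0 → ¬ MeetsEgg W → BSDp W 2 := by
  intro W _ _ hcm hr hSel hρ hΔ hC0 hegg
  -- rank one (GZK)
  have hrk : W.mordellWeilRank = 1 := by rw [(hGZK W (le_of_eq hr)).1, hr]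
  -- `W(ℚ)[2] = 0` from `ρ̄_{W,2}` onto
  have hT : NoRationalTwoTorsion W :=
    GenusKolyTwin.noRationalTwoTorsion_of_hasSurjectiveModNGaloisRep W (by simpa using hρ 1)
  -- `Ш(W)[2] = 0` from `#Sel₂ = 2` at rank `≥ 1`
  have hSha : ShaTwoTrivial W := Egg.shaTwoTrivial_of_natCard_selmerGroup_eq_two W hSel (le_of_eq hrk.symm)
  -- `∏ c_ℓ` odd from `ord₂ C = 0`
  have hodd : ¬ 2 ∣ W.tamagawaProduct := fun h2 ↦ by
    have h1 : 1 ≤ padicValNat 2 W.tamagawaProduct := one_le_padicValNat_of_dvd W.tamagawaProduct_pos_holds.ne' h2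
    omega
  exact hSid W hcm hρ hr ⟨hΔ, hT, hSha, hegg, hodd⟩

/-- **The bridge in the habitat's cast** (`∀ n ≥ 1, ρ̄_{W,(2:ℤ)^n}` onto), for callers holding the route's own binder shape.
CONDITIONAL on the displayed hypotheses; proves nothing about BSD by itself; closes nothing.
[cite: SilvermanAEC2009, X.4.2] [cite: Kolyvagin1989Izv, Thm. A] -/
theorem hTw0idSharp_of_idLocus_of_GZK' (hGZK : rank_eq_analyticRank_of_analyticRank_le_one)
    (hSid : ∀ (W : WeierstrassCurve ℚ) [W.IsElliptic] [W.IsGloballyMinimal], ¬ W.HasCM →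
      (∀ n : ℕ, W.HasSurjectiveModNGaloisRep ((2 ^ n : ℕ) : ℤ)) → W.analyticRank = 1 →
      (0 < W.Δ ∧ Summit.BirchSwinnertonDyer.Rank1Residual.F1Sign2.NoRationalTwoTorsion W ∧
        Summit.BirchSwinnertonDyer.Rank1Residual.F1Sign2.ShaTwoTrivial W ∧
        ¬ Summit.BirchSwinnertonDyer.Rank1Residual.F1Sign2.MeetsEgg W ∧ ¬ 2 ∣ W.tamagawaProduct) →
      Literature.NumberTheory.EllipticCurves.BSDp W 2) :
    ∀ (W : WeierstrassCurve ℚ) [W.IsElliptic] [W.IsGloballyMinimal], ¬ W.HasCM → W.analyticRank = 1 →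
      Nat.card (W.selmerGroup 2) = 2 → (∀ n : ℕ, 0 < n → W.HasSurjectiveModNGaloisRep ((2 : ℤ) ^ n)) → 0 < W.Δ →
      padicValNat 2 W.tamagawaProduct = 0 → ¬ MeetsEgg W → BSDp W 2 :=
  fun W _ _ hcm hr hSel hρ hΔ hC0 hegg ↦
    hTw0idSharp_of_idLocus_of_GZK hGZK hSid W hcm hr hSel (forall_hasSurjectiveModNGaloisRep_two_pow_cast W hρ) hΔ hC0 hegg

/-! ## §3 `closes` (rev 57) consumes U₂ only on curves with SURJECTIVE 2-ADIC IMAGE: the ♯-sliced ledger -/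

/-- **THE ROUTE (rev 57) CONSUMES U₂ ONLY ON CURVES OF THE TWO TAMAGAWA CELLS WITH SURJECTIVE 2-ADIC IMAGE.**  `GenusKolyvaginAtTwo.closes`
(rev 57) with its binder `hTw : MinimalTwinBSDTwo` REPLACED by `hTw0♯` — `BSD₂(W)` for non-CM globally minimal `W` of analytic rank `1` with
`#Sel₂(W) = 2`, **`ρ̄_{W,2ⁿ}` onto for every `n`**, `0 < Δ_W`, `ord₂ C(W) = 0` — and `hTw1♯` — the same with `Δ_W < 0`, `ord₂ C(W) = 1`; all
other binders and every proof line VERBATIM from this seat's S₃-sliced ledger `nonCMAtTwo_of_items_of_tamagawaSlicedSurjTwin_line25`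
(p769550), except that at each call site the twin inherits the FULL 2-adic tower from the habitat curve (§1) instead of `ρ̄₂` only.  Since
`hTw0ˢ ⟹ hTw0♯` and `hTw1ˢ ⟹ hTw1♯` trivially, every ledger built on p769550 / p770584 holds with the ♯-cells.
CONDITIONAL on the route's items (as `closes` is); proves nothing about BSD by itself; closes no item.
[cite: DokchitserDokchitserMathZ2012, Theorem (1)–(3)] [cite: Kramer1981, §2 Prop. 3] [cite: Miller2011LMS, Def. 1.1] -/
theorem nonCMAtTwo_of_items_of_tamagawaSlicedSharpTwin_line25
    (hP : GenusPrimitiveSupplyAtTwoPosDiscShallow) (hPG : GenusDeepSupplyAtTwoNegDiscNarrow) (hQ1 : CyclicTorsionOfNegDisc)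
    (hQ2 : KolyvaginRelationAtTwo)
    (hQ5R : EquivariantChebotarevAtTwoR) (hQ3RT : EquivariantKolyvaginExactAtTwoRT)
    (hQ4T : KolyvaginExactAtTwoPosDiscT) (hGf : ExactDescentAtTwoOfFourFacts)
    (hR : OffHabitatResidualAtTwo) (hOff : OffCutResidualAtTwoR)
    (hK1P : K1Pos) (hK1N : K1Neg) (hSha1 : ShaVanishingAtDepthZeroAtTwo)
    (hTw0sh : ∀ (W : WeierstrassCurve ℚ) [W.IsElliptic] [W.IsGloballyMinimal], ¬ W.HasCM → W.analyticRank = 1 →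
      Nat.card (W.selmerGroup 2) = 2 → (∀ n : ℕ, W.HasSurjectiveModNGaloisRep ((2 ^ n : ℕ) : ℤ)) → 0 < W.Δ →
      padicValNat 2 W.tamagawaProduct = 0 → BSDp W 2)
    (hTw1sh : ∀ (W : WeierstrassCurve ℚ) [W.IsElliptic] [W.IsGloballyMinimal], ¬ W.HasCM → W.analyticRank = 1 →
      Nat.card (W.selmerGroup 2) = 2 → (∀ n : ℕ, W.HasSurjectiveModNGaloisRep ((2 ^ n : ℕ) : ℤ)) → W.Δ < 0 →
      padicValNat 2 W.tamagawaProduct = 1 → BSDp W 2)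
    (hL : EntireLFunctionRat)
    (hGZ : GrossZagierAllLevels) (hGZK : MultPublishedInputsAtTwo) (hMi : MilneAnyModel) :
    NonCMAtTwo := by
  have hG : ExactDescentAtTwo := hGf ⟨hGZ, hGZK, hL, hMi⟩
  intro W _ _ hcm hr
  haveI : NeZero (W.conductorNorm ℤ) := ⟨(W.conductorNorm_pos_holds).ne'⟩
  by_cases hH : (W.analyticRank = 0 ∧ (∀ n : ℕ, 0 < n → W.HasSurjectiveModNGaloisRep ((2 : ℤ) ^ n)) ∧
        Odd W.tamagawaProduct ∧
        ∃ Dt : Literature.NumberTheory.EllipticCurves.ModularForms.ModularParametrizationData W (W.conductorNorm ℤ),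
          (∀ z ∈ Dt.L.lattice, ∃ w ∈ Literature.NumberTheory.EllipticCurves.ModularForms.periodLattice Dt.f, z = (Dt.c : ℂ) * w) ∧ Odd Dt.c)
  · obtain ⟨hr0, hρ, hT, hopt⟩ := hH
    haveI : Fact (Nat.Prime 2) := ⟨Nat.prime_two⟩
    -- an elliptic curve has `Δ ≠ 0`
    have hΔ : W.Δ ≠ 0 := by rw [← WeierstrassCurve.coe_Δ']; exact W.Δ'.ne_zero
    -- `w(E) = +1` from `r_an(E) = 0` (used on both signs)
    have hw : ∀ Dt : Literature.NumberTheory.EllipticCurves.ModularForms.ModularParametrizationData W (W.conductorNorm ℤ),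
        W.rootNumber = 1 := fun Dt ↦
      (Literature.Barriers.BirchSwinnertonDyer.even_analyticRank_iff_of_isNewformOf_conductorLevel Dt.isNewformOf).mp
        (by rw [hr0]; exact Even.zero)
    -- the two cells, once per sign: the consumed twin has `ρ̄_{2^n}` onto for EVERY `n` (§1), `sign Δ(Wd) = sign Δ_E` and
    -- `ord₂ C(Wd) = 1` resp. `= 0`
    have hcell1 : W.Δ < 0 → ∀ (K : Type) [Field K] [NumberField K], IsImaginaryQuadratic K → Odd (NumberField.discr K) →
        SatisfiesHeegnerHypothesis (W.conductorNorm ℤ) K → ∀ (Wd : WeierstrassCurve ℚ) [Wd.IsElliptic] [Wd.IsGloballyMinimal],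
        (∃ C : VariableChange ℚ, C • W.quadraticTwist (NumberField.discr K : ℚ) = Wd) → ¬ Wd.HasCM → Wd.analyticRank = 1 →
        Nat.card (Wd.selmerGroup 2) = 2 → padicValNat 2 Wd.tamagawaProduct ≤ 1 → BSDp Wd 2 := by
      intro hneg K _ _ hIQ hodd hHe Wd _ _ hWd hcmd hrd hSel hDEF
      obtain ⟨Cd, hCd⟩ := hWd
      have hD0 : (NumberField.discr K : ℚ) ≠ 0 := by exact_mod_cast NumberField.discr_ne_zero K
      haveI := W.isElliptic_quadraticTwist hD0
      have hΔd : Wd.Δ < 0 := (Δ_twin_neg_iff W hD0 Cd hCd).mpr hneg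
      obtain ⟨k, hk⟩ := odd_padicValNat_two_tamagawaProduct_twin_of_Δ_neg W hIQ hodd hHe hT hneg Cd hCd
      have h1 : padicValNat 2 Wd.tamagawaProduct = 1 := by omega
      have hρd : ∀ n : ℕ, Wd.HasSurjectiveModNGaloisRep ((2 ^ n : ℕ) : ℤ) :=
        forall_hasSurjectiveModNGaloisRep_two_pow_of_model_twist W hρ hD0 Cd hCd
      exact hTw1sh Wd hcmd hrd hSel hρd hΔd h1
    have hcell0 : 0 < W.Δ → ∀ (K : Type) [Field K] [NumberField K],
        ∀ (Wd : WeierstrassCurve ℚ) [Wd.IsElliptic] [Wd.IsGloballyMinimal],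
        (∃ C : VariableChange ℚ, C • W.quadraticTwist (NumberField.discr K : ℚ) = Wd) → ¬ Wd.HasCM → Wd.analyticRank = 1 →
        Nat.card (Wd.selmerGroup 2) = 2 → padicValNat 2 Wd.tamagawaProduct = 0 → BSDp Wd 2 := by
      intro hpos K _ _ Wd _ _ hWd hcmd hrd hSel hTam
      obtain ⟨Cd, hCd⟩ := hWd
      have hD0 : (NumberField.discr K : ℚ) ≠ 0 := by exact_mod_cast NumberField.discr_ne_zero K
      haveI := W.isElliptic_quadraticTwist hD0
      have hΔd : 0 < Wd.Δ := (Δ_twin_pos_iff W hD0 Cd hCd).mpr hpos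
      have hρd : ∀ n : ℕ, Wd.HasSurjectiveModNGaloisRep ((2 ^ n : ℕ) : ℤ) :=
        forall_hasSurjectiveModNGaloisRep_two_pow_of_model_twist W hρ hD0 Cd hCd
      exact hTw0sh Wd hcmd hrd hSel hρd hΔd hTam
    rcases lt_or_gt_of_ne hΔ with hneg | hpos
    · -- `Δ < 0`
      by_cases hmult : ∃ v : IsDedekindDomain.HeightOneSpectrum (NumberField.RingOfIntegers ℚ),
          ((2 : ℕ) : NumberField.RingOfIntegers ℚ) ∉ v.asIdeal ∧
          ((W.conductorNorm ℤ : ℕ) : NumberField.RingOfIntegers ℚ) ∈ v.asIdeal ∧ W.HasMultiplicativeReductionAt v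
      · by_cases h14 : Nat.card (W.selmerGroup 2) = 1 ∨ Nat.card (W.selmerGroup 2) = 4
        · obtain ⟨v, h2v, hNv, hmv⟩ := hmult
          obtain ⟨K, _, _, hIQ, hodd, h3, hHe, hsq1, hsq2, Dt, β, ι, d₁, hoptDt, hc, hy, M₀, hdiv, hndiv,
            n, d, hn, hKoly, hPn, Wd, _, _, hWd, hcmd, hrd, hSel, hDEF⟩ := hPG W hcm hr0 hρ hT hneg hopt h14
          have hBd : Literature.NumberTheory.EllipticCurves.BSDp Wd 2 := hcell1 hneg K hIQ hodd hHe Wd hWd hcmd hrd hSel hDEF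
          exact hG W hcm hr0 hρ hT K hIQ hodd h3 hHe Dt hoptDt hc β ι d₁ hy M₀ hdiv hndiv
            (hQ3RT hQ2 hQ5R hQ1 W hcm hT v h2v hNv hmv hneg K hIQ hodd h3 hHe hsq1 hsq2 hρ Dt β ι d₁ hy M₀ hdiv hndiv
              (hw Dt) Wd hWd hSel hDEF n d hn hKoly hPn)
            Wd hWd hSel hBd
        · exact hOff W hcm hr0 hρ hT hopt (Or.inr (Or.inl ⟨hneg, h14⟩))
      · -- rev 54 (LINE 25 «s1_depth_zero»): additive-only at DEPTH ZERO — supply VERBATIM, K₁, v-free `Ш(E/K)[2^∞] = 0`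
        by_cases h1 : Nat.card (W.selmerGroup 2) = 1
        · obtain ⟨K, _, _, hIQ, hodd, h3, hHe, hsq1, hsq2, Dt, β, ι, d₁, hoptDt, hc, hy, M₀, hdiv, hndiv,
            n, d, hn, hKoly, hPn, Wd, _, _, hWd, hcmd, hrd, hSel, hDEF⟩ := hPG W hcm hr0 hρ hT hneg hopt (Or.inl h1)
          have hM0 : M₀ = 0 := by
            by_contra hne
            exact hK1N W hcm hr0 hρ hT hneg h1 K hIQ hodd h3 hHe hsq1 hsq2 Dt hoptDt hc β ι d₁ hy M₀ hdiv hndiv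
              (Nat.one_le_iff_ne_zero.mpr hne) Wd hWd hrd hSel hDEF
          subst hM0
          have hSha : Nat.card (AddCommGroup.primaryComponent (W.baseChange K).sha 2) = 2 ^ (2 * 0) := by
            rw [mul_zero, pow_zero]
            exact hSha1 W K hT hr0 h1 hIQ hodd hHe (by simpa using hρ 1 one_pos) Dt β ι d₁ hy 0 hndiv Wd hWd hSel
              (Or.inl ⟨hneg, hDEF⟩)
          have hBd : Literature.NumberTheory.EllipticCurves.BSDp Wd 2 := hcell1 hneg K hIQ hodd hHe Wd hWd hcmd hrd hSel hDEF
          exact hG W hcm hr0 hρ hT K hIQ hodd h3 hHe Dt hoptDt hc β ι d₁ hy 0 hdiv hndiv hSha Wd hWd hSel hBd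
        · exact hOff W hcm hr0 hρ hT hopt (Or.inl ⟨hmult, h1⟩)
    · -- `Δ > 0`
      by_cases hmult : ∃ v : IsDedekindDomain.HeightOneSpectrum (NumberField.RingOfIntegers ℚ),
          ((2 : ℕ) : NumberField.RingOfIntegers ℚ) ∉ v.asIdeal ∧
          ((W.conductorNorm ℤ : ℕ) : NumberField.RingOfIntegers ℚ) ∈ v.asIdeal ∧ W.HasMultiplicativeReductionAt v
      · by_cases h14 : Nat.card (W.selmerGroup 2) = 1 ∨ (Nat.card (W.selmerGroup 2) = 4 ∧
            ∃ c ∈ (W.kummerSelmerStructure ((2 : ℕ) : ℤ)).selmerGroup,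
              Literature.NumberTheory.GaloisRepresentations.galoisCohomology.localization (W.torsionGaloisModule ((2 : ℕ) : ℤ))
                (Sum.inl Rat.infinitePlace) 1 c ≠ 0)
        · obtain ⟨v, h2v, hNv, hmv⟩ := hmult
          obtain ⟨K, _, _, hIQ, hodd, h3, hHe, hsq1, hsq2, Dt, β, ι, d₁, hoptDt, hc, hy, M₀, hdiv, hndiv,
            n, d, hn, hKoly, hPn, Wd, _, _, hWd, hcmd, hrd, hSel, hTam⟩ := hP W hcm hr0 hρ hT hpos hopt h14
          have hBd : Literature.NumberTheory.EllipticCurves.BSDp Wd 2 := hcell0 hpos K Wd hWd hcmd hrd hSel hTam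
          exact hG W hcm hr0 hρ hT K hIQ hodd h3 hHe Dt hoptDt hc β ι d₁ hy M₀ hdiv hndiv
            (hQ4T hQ2 W hcm hT v h2v hNv hmv hpos K hIQ hodd h3 hHe hsq1 hsq2 hρ Dt β ι d₁ hy M₀ hdiv hndiv (hw Dt) Wd hWd hSel hTam
              n d hn hKoly hPn)
            Wd hWd hSel hBd
        · exact hOff W hcm hr0 hρ hT hopt (Or.inr (Or.inr ⟨hpos, h14⟩))
      · -- rev 54 (LINE 25 «s1_depth_zero»): additive-only at DEPTH ZERO — supply VERBATIM, K₁⁺, v-free `Ш(E/K)[2^∞] = 0`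
        by_cases h1 : Nat.card (W.selmerGroup 2) = 1
        · obtain ⟨K, _, _, hIQ, hodd, h3, hHe, hsq1, hsq2, Dt, β, ι, d₁, hoptDt, hc, hy, M₀, hdiv, hndiv,
            n, d, hn, hKoly, hPn, Wd, _, _, hWd, hcmd, hrd, hSel, hDEF⟩ := hP W hcm hr0 hρ hT hpos hopt (Or.inl h1)
          have hM0 : M₀ = 0 := by
            by_contra hne
            exact hK1P W hcm hr0 hρ hT hpos h1 K hIQ hodd h3 hHe hsq1 hsq2 Dt hoptDt hc β ι d₁ hy M₀ hdiv hndiv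
              (Nat.one_le_iff_ne_zero.mpr hne) Wd hWd hrd hSel hDEF
          subst hM0
          have hSha : Nat.card (AddCommGroup.primaryComponent (W.baseChange K).sha 2) = 2 ^ (2 * 0) := by
            rw [mul_zero, pow_zero]
            exact hSha1 W K hT hr0 h1 hIQ hodd hHe (by simpa using hρ 1 one_pos) Dt β ι d₁ hy 0 hndiv Wd hWd hSel
              (Or.inr ⟨hpos, hDEF⟩)
          have hBd : Literature.NumberTheory.EllipticCurves.BSDp Wd 2 := hcell0 hpos K Wd hWd hcmd hrd hSel hDEF
          exact hG W hcm hr0 hρ hT K hIQ hodd h3 hHe Dt hoptDt hc β ι d₁ hy 0 hdiv hndiv hSha Wd hWd hSel hBd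
        · exact hOff W hcm hr0 hρ hT hopt (Or.inl ⟨hmult, h1⟩)
  · exact hR W hcm hr hH

/-! ## §4 The egg-split ledger with the residual DISCHARGED onto `S_id`: U₂ ↦ «S1⁺ + S1⁻ + S2″⁺ + S2⁻′ + S_id» -/

/-- **THE MERGED LEDGER ON REV 57: U₂ ↦ «S1⁺ + S1⁻ + S2″⁺ + S2⁻′ + `S_id`» — NO RESIDUAL OF LINE 23 INSIDE THE CONSUMED CELLS.**
This seat's egg-split ledger `nonCMAtTwo_of_items_of_slicedWall_of_reversedSuppliesEgg_line25` (p770584: binders = the route's items as in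
`closes` rev 57, the sliced wall S1⁺/S1⁻, LINE 23 v1.5's egg-restricted reversed supply S2″⁺, the prime-frame depth-one supply S2⁻′, PRINT, and
the DECLARED RESIDUAL `hTw0id`) with `hTw0id` REPLACED by **`hSid` = the sibling route's `S_id`** (signature VERBATIM = support item
`RankOneAtTwoBigImageIdLocus` of route `ByReductionTypeAtTwo`, crux 23715; director (548)(A): ONE item, TWO routes).  Proof: the ♯-sliced
`closes` of §3; `hTw0♯` split on `MeetsEgg` — the egg half by p770584 §1 (`hTw0egg_of_slicedWall_of_reversedSupplyExponentEgg_of_facts`: S1⁺ +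
S2″⁺ + PRINT), the identity half by the bridge of §2 (`S_id` + GZK, the full tower being available on the ♯-cell); `hTw1♯` by p768862's
`hTw1_of_slicedWall_of_reversedSupplyDepthOnePrime_of_facts` (S1⁻ + S2⁻′ + PRINT).  -imc's small-image remainder S4″b₂ does not occur.
CONDITIONAL on the displayed hypotheses (all beyond print except the four statement-only PRINT facts); proves nothing about BSD by itself;
closes no item.  [cite: Kramer1981, §2 Props. 3, 6] [cite: MazurRubin2010, Cor. 3.4 (i) and Prop. 3.3] [cite: GrossZagier1986, V.§2 (2.2)]
[cite: DokchitserDokchitserMathZ2012, Theorem (1)–(3)] [cite: Miller2011LMS, Def. 1.1] -/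
theorem nonCMAtTwo_of_items_of_slicedWall_of_reversedSuppliesEgg_of_idLocus_line25
    (hP : GenusPrimitiveSupplyAtTwoPosDiscShallow) (hPG : GenusDeepSupplyAtTwoNegDiscNarrow) (hQ1 : CyclicTorsionOfNegDisc)
    (hQ2 : KolyvaginRelationAtTwo)
    (hQ5R : EquivariantChebotarevAtTwoR) (hQ3RT : EquivariantKolyvaginExactAtTwoRT)
    (hQ4T : KolyvaginExactAtTwoPosDiscT) (hGf : ExactDescentAtTwoOfFourFacts)
    (hR : OffHabitatResidualAtTwo) (hOff : OffCutResidualAtTwoR)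
    (hK1P : K1Pos) (hK1N : K1Neg) (hSha1 : ShaVanishingAtDepthZeroAtTwo)
    (hS1pos : ∀ (W : WeierstrassCurve ℚ) [W.IsElliptic] [W.IsGloballyMinimal],
      ¬ W.HasCM → W.analyticRank = 0 → Nat.card (W.selmerGroup 2) = 1 → 0 < W.Δ → padicValNat 2 W.tamagawaProduct = 0 → BSDp W 2)
    (hS1neg : ∀ (W : WeierstrassCurve ℚ) [W.IsElliptic] [W.IsGloballyMinimal],
      ¬ W.HasCM → W.analyticRank = 0 → Nat.card (W.selmerGroup 2) = 1 → W.Δ < 0 → padicValNat 2 W.tamagawaProduct = 2 → BSDp W 2)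
    (hS2egg : ∀ (W : WeierstrassCurve ℚ) [W.IsElliptic] [W.IsGloballyMinimal] [NeZero (W.conductorNorm ℤ)],
      ¬ W.HasCM → W.analyticRank = 1 → Nat.card (W.selmerGroup 2) = 2 → Odd W.tamagawaProduct → (W.Δ < 0 ∨ MeetsEgg W) →
      ∃ (K : Type) (_ : Field K) (_ : NumberField K),
        IsImaginaryQuadratic K ∧ Odd (NumberField.discr K) ∧ NumberField.discr K ≠ -3 ∧ SatisfiesHeegnerHypothesis (W.conductorNorm ℤ) K ∧
        ∃ (Dt : ModularParametrizationData W (W.conductorNorm ℤ)) (β : ℤ) (ι : K →+* ℂ) (d₁ : KolyvaginHeegnerData Dt β ι 1),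
          Dt.c ≠ 0 ∧ ¬ IsOfFinAddOrder d₁.derivedPoint ∧
          (∃ M₀ : ℕ, padicValInt 2 Dt.c = M₀ ∧
            (∃ Q : (W.baseChange (ringClassField K ι 1)).toAffine.Point, ((2 ^ M₀ : ℕ) : ℤ) • Q = d₁.derivedPoint) ∧
            (¬ ∃ Q : (W.baseChange (ringClassField K ι 1)).toAffine.Point, ((2 ^ (M₀ + 1) : ℕ) : ℤ) • Q = d₁.derivedPoint)) ∧
          ∃ (Wd : WeierstrassCurve ℚ) (_ : Wd.IsElliptic) (_ : Wd.IsGloballyMinimal),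
            (∃ C : VariableChange ℚ, C • W.quadraticTwist (NumberField.discr K : ℚ) = Wd) ∧ Nat.card (Wd.selmerGroup 2) = 1 ∧
            ((W.Δ < 0 ∧ padicValNat 2 Wd.tamagawaProduct ≤ 1) ∨ padicValNat 2 Wd.tamagawaProduct = 0))
    (hS2p : ∀ (W : WeierstrassCurve ℚ) [W.IsElliptic] [W.IsGloballyMinimal] [NeZero (W.conductorNorm ℤ)],
      ¬ W.HasCM → W.analyticRank = 1 → Nat.card (W.selmerGroup 2) = 2 → W.Δ < 0 → padicValNat 2 W.tamagawaProduct = 1 →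
      ∃ (K : Type) (_ : Field K) (_ : NumberField K),
        IsImaginaryQuadratic K ∧ (∃ ℓ : ℕ, ℓ.Prime ∧ NumberField.discr K = -(ℓ : ℤ)) ∧ Odd (NumberField.discr K) ∧
        NumberField.discr K ≠ -3 ∧ SatisfiesHeegnerHypothesis (W.conductorNorm ℤ) K ∧
        ∃ (Dt : ModularParametrizationData W (W.conductorNorm ℤ)) (β : ℤ) (ι : K →+* ℂ) (d₁ : KolyvaginHeegnerData Dt β ι 1),
          Dt.c ≠ 0 ∧ ¬ IsOfFinAddOrder d₁.derivedPoint ∧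
          (∃ Q : (W.baseChange (ringClassField K ι 1)).toAffine.Point,
            ((2 ^ (padicValInt 2 Dt.c + 1) : ℕ) : ℤ) • Q = d₁.derivedPoint) ∧
          (¬ ∃ Q : (W.baseChange (ringClassField K ι 1)).toAffine.Point,
            ((2 ^ (padicValInt 2 Dt.c + 1 + 1) : ℕ) : ℤ) • Q = d₁.derivedPoint) ∧
          ∃ (Wd : WeierstrassCurve ℚ) (_ : Wd.IsElliptic) (_ : Wd.IsGloballyMinimal),
            (∃ C : WeierstrassCurve.VariableChange ℚ, C • W.quadraticTwist (NumberField.discr K : ℚ) = Wd) ∧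
            Nat.card (Wd.selmerGroup 2) = 1)
    (hSid : ∀ (W : WeierstrassCurve ℚ) [W.IsElliptic] [W.IsGloballyMinimal], ¬ W.HasCM →
      (∀ n : ℕ, W.HasSurjectiveModNGaloisRep ((2 ^ n : ℕ) : ℤ)) → W.analyticRank = 1 →
      (0 < W.Δ ∧ Summit.BirchSwinnertonDyer.Rank1Residual.F1Sign2.NoRationalTwoTorsion W ∧
        Summit.BirchSwinnertonDyer.Rank1Residual.F1Sign2.ShaTwoTrivial W ∧
        ¬ Summit.BirchSwinnertonDyer.Rank1Residual.F1Sign2.MeetsEgg W ∧ ¬ 2 ∣ W.tamagawaProduct) →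
      Literature.NumberTheory.EllipticCurves.BSDp W 2)
    (hL : EntireLFunctionRat)
    (hGZ : GrossZagierAllLevels) (hGZK : MultPublishedInputsAtTwo) (hMi : MilneAnyModel) :
    NonCMAtTwo :=
  nonCMAtTwo_of_items_of_tamagawaSlicedSharpTwin_line25 hP hPG hQ1 hQ2 hQ5R hQ3RT hQ4T hGf hR hOff hK1P hK1N hSha1
    (fun W _ _ hcm hr hSel hρ hΔ hC0 ↦ by
      by_cases hegg : MeetsEgg W
      · exact hTw0egg_of_slicedWall_of_reversedSupplyExponentEgg_of_facts hGZ hGZK hL hMi hS1pos hS2egg W hcm hr hSel hΔ hC0 hegg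
      · exact hTw0idSharp_of_idLocus_of_GZK hGZK hSid W hcm hr hSel hρ hΔ hC0 hegg)
    (fun W _ _ hcm hr hSel _ hΔ hC1 ↦
      hTw1_of_slicedWall_of_reversedSupplyDepthOnePrime_of_facts hGZ hGZK hL hMi hS1neg hS2p W hcm hr hSel hΔ hC1)
    hL hGZ hGZK hMi

end Summit.BirchSwinnertonDyer.BirchSwinnertonDyer.Theorems.GenusExact.TwinSwap.Ledger.Line25

end
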